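import Literature.Computability.QuantumComplexity.CoinPrefix
import Literature.Computability.Cryptography.IndepLawBridge
import HarnessLib

/-!
# Laws of what is READ off the output of a classical wrap, and of a coin-prefixed family

Topic `Literature/Computability/QuantumComplexity`; law-level companions of `CWrap*.lean`
(classical pre- and post-processing `h`, `g ∈ FP` around a quantum family `F`: on input `x` the wrapped
family writes `g ⟨x, y⟩`, `y` the measured register of `F` run on `h x`, at the FRONT of its
register — `CWrap.kernelProb_family_ge`, an eventwise lower bound) and of `CoinPrefix.lean` (Hadamard
coins `c ∈ {0,1}^{k(|x|)}` appended to the input of an input-recoverable family —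
`CoinPrefix.kernelProb_family_eq`, the exact mixture of event probabilities). Consumers read a
VALUE off the output string by a total classical reader that only looks at the `g`-prefix (a
self-delimited code written by `g`); for them the eventwise statements become identities of laws:

* `CWrap.support_kernel_subset` — every possible output of the wrapped family has a prefix
  `g ⟨x, y⟩` with `y` a possible output of `F` on `h x` (the bound with the sure event);
* **`CWrap.map_kernel_eq_of_read`** — if `read w = R y` whenever `g ⟨x, y⟩` is a prefix of `w`
  (`y` in the support), then the law of `read` under the wrapped family's kernel IS the law of `R`
  under `F`'s kernel at `h x`: `((family P).kernel 0 x).map read = (F.kernel 0 (h x)).map R`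
  (eventwise domination of two laws of total mass one, `PMF.eq_of_forall_toOuterMeasure_le`);
* **`CoinPrefix.kernel_eq_bind`** — the kernel of the coin-prefixed family IS the uniform mixture of
  the kernels of the branches: `(family P).kernel 0 x = (U {0,1}^k).bind fun c => F.kernel 0 (x ++ c)`
  (from `kernelProb_family_eq` on singletons); `CoinPrefix.support_kernel_subset` (every possible
  output is a possible output of some branch).

Everything is proved; no named fact.

## References

* E. Bernstein, U. Vazirani, *Quantum complexity theory*, SIAM J. Comput. 26 (1997), §8 (classical
  computation inside quantum machines) and Thm. 8.3 (Hadamard coins) [BernsteinVazirani1997].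
* M. A. Nielsen, I. L. Chuang, *Quantum Computation and Quantum Information*, CUP 2010, §2.2.5,
  §4.4 [NielsenChuang2010].
* O. Goldreich, *Foundations of Cryptography* I, CUP 2001, §3.2.1 (laws determined by all event
  probabilities) [Goldreich2001].
-/

noncomputable section

namespace Literature.Computability.QuantumComplexity

open _root_.Computability Complexity Cryptography Finset
open scoped ENNReal

/-! ### Generic: probabilities of a kernel as outer measures -/

/-- Kernel probabilities as real parts of outer measures. [folklore] -/
theorem kernelProb_eq_toReal_toOuterMeasure (F : QCircuitFamily cliffordT) (A : Language Bool) (x : List Bool)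
    (E : Set (List Bool)) : F.kernelProb A x E = ((F.kernel A x).toOuterMeasure E).toReal := rfl

/-- Probabilities of a `PMF` are finite. [folklore] -/
theorem toOuterMeasure_ne_top' {α : Type*} (p : PMF α) (E : Set α) : p.toOuterMeasure E ≠ ⊤ :=
  ne_top_of_le_ne_top ENNReal.one_ne_top
    ((p.toOuterMeasure_mono (Set.subset_univ _)).trans_eq ((p.toOuterMeasure_apply_eq_one_iff _).2 (Set.subset_univ _)))

/-! ### Classical wraps: support and read-off laws -/

namespace CWrap

variable (P : CWrap.Params) (x : List Bool)

/-- **Every possible output of the wrapped family starts with `g ⟨x, y⟩` for a possible output `y` of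
the wrapped family `F` on `h x`.** [cite: BernsteinVazirani1997, §8] -/
theorem support_kernel_subset :
    ((family P).kernel 0 x).support ⊆ {w | ∃ y ∈ (P.F.kernel 0 (P.h x)).support, P.g (boolPair x y) <+: w} := by
  set T : Set (List Bool) := {w | ∃ y ∈ (P.F.kernel 0 (P.h x)).support, P.g (boolPair x y) <+: w} with hT
  have hge := kernelProb_family_ge P (x := x) fun v => (P.F.kernel 0 v).support
  rw [kernelProb_eq_toReal_toOuterMeasure, kernelProb_eq_toReal_toOuterMeasure,
    (PMF.toOuterMeasure_apply_eq_one_iff _ _).2 subset_rfl, ENNReal.toReal_one] at hge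
  change (1 : ℝ) ≤ (((family P).kernel 0 x).toOuterMeasure T).toReal at hge
  have hle : ((family P).kernel 0 x).toOuterMeasure T ≤ 1 :=
    (PMF.toOuterMeasure_mono _ (Set.subset_univ _)).trans_eq ((PMF.toOuterMeasure_apply_eq_one_iff _ _).2 (Set.subset_univ _))
  have h1 : (1 : ℝ≥0∞) ≤ ((family P).kernel 0 x).toOuterMeasure T :=
    (ENNReal.toReal_le_toReal ENNReal.one_ne_top (toOuterMeasure_ne_top' _ _)).1 (by rwa [ENNReal.toReal_one])
  exact (PMF.toOuterMeasure_apply_eq_one_iff _ _).1 (le_antisymm hle h1)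

/-- **The law of a value read off the `g`-prefix.** If a total reader `read` of the output string
returns `R y` on every string with prefix `g ⟨x, y⟩`, `y` a possible output of `F` on `h x`, then
`((family P).kernel 0 x).map read = (F.kernel 0 (h x)).map R`: for every event the right-hand side
is dominated by the left (`kernelProb_family_ge` with the event `R⁻¹ T ∩ support`), and both are
laws. [cite: BernsteinVazirani1997, §8; Goldreich2001, §3.2.1] -/
theorem map_kernel_eq_of_read {β : Type} (read : List Bool → β) (R : List Bool → β)
    (hR : ∀ y ∈ (P.F.kernel 0 (P.h x)).support, ∀ w : List Bool, P.g (boolPair x y) <+: w → read w = R y) :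
    ((family P).kernel 0 x).map read = (P.F.kernel 0 (P.h x)).map R := by
  refine PMF.eq_of_forall_toOuterMeasure_le fun T => ?_
  rw [PMF.toOuterMeasure_map_apply, PMF.toOuterMeasure_map_apply, ← PMF.toOuterMeasure_apply_inter_support]
  have hge := kernelProb_family_ge P (x := x) fun v => (R ⁻¹' T) ∩ (P.F.kernel 0 v).support
  rw [kernelProb_eq_toReal_toOuterMeasure, kernelProb_eq_toReal_toOuterMeasure,
    ENNReal.toReal_le_toReal (toOuterMeasure_ne_top' _ _) (toOuterMeasure_ne_top' _ _)] at hge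
  refine hge.trans (PMF.toOuterMeasure_mono _ ?_)
  rintro w ⟨⟨y, ⟨hyT, hy⟩, hpre⟩, -⟩
  show read w ∈ T
  rw [hR y hy w hpre]
  exact hyT

end CWrap

/-! ### Coin prefixes: the kernel as a mixture -/

namespace CoinPrefix

variable (P : CoinPrefix.Params)

/-- **The kernel of the coin-prefixed family is the uniform mixture of the kernels of its branches**
(input-recoverable `F`). [cite: BernsteinVazirani1997, Thm. 8.3 (proof: Hadamard coins); NielsenChuang2010, §4.4] -/
theorem kernel_eq_bind (hρ : P.F.InputRecoverable) (x : List Bool) :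
    (family P).kernel 0 x =
      (PMF.uniformOfFintype (QReg (k P x.length))).bind fun c => P.F.kernel 0 (x ++ List.ofFn c) := by
  classical
  refine PMF.ext fun w => ?_
  have h := kernelProb_family_eq P hρ x {w}
  rw [kernelProb_eq_toReal_toOuterMeasure, PMF.toOuterMeasure_apply_singleton] at h
  simp only [kernelProb_eq_toReal_toOuterMeasure, PMF.toOuterMeasure_apply_singleton] at h
  -- pass to `ℝ≥0∞`
  rw [PMF.bind_apply, tsum_fintype]
  have hfin : ∀ c : QReg (k P x.length), P.F.kernel 0 (x ++ List.ofFn c) w ≠ ⊤ := fun c => PMF.apply_ne_top _ _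
  apply (ENNReal.toReal_eq_toReal_iff' (PMF.apply_ne_top _ _) (ENNReal.sum_ne_top.2 fun c _ =>
    ENNReal.mul_ne_top (PMF.apply_ne_top _ _) (hfin c))).1
  rw [h, ENNReal.toReal_sum fun c _ => ENNReal.mul_ne_top (PMF.apply_ne_top _ _) (hfin c), Finset.mul_sum]
  refine Finset.sum_congr rfl fun c _ => ?_
  rw [ENNReal.toReal_mul, PMF.uniformOfFintype_apply, ENNReal.toReal_inv, ENNReal.toReal_natCast, Fintype.card_fun,
    Fintype.card_bool, Fintype.card_fin, Nat.cast_pow, Nat.cast_ofNat, one_div, inv_pow]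

/-- **Every possible output of the coin-prefixed family is a possible output of some branch.** [folklore] -/
theorem support_kernel_subset (hρ : P.F.InputRecoverable) (x : List Bool) :
    ((family P).kernel 0 x).support ⊆ ⋃ c : QReg (k P x.length), (P.F.kernel 0 (x ++ List.ofFn c)).support := by
  intro w hw
  rw [kernel_eq_bind P hρ, PMF.mem_support_bind_iff] at hw
  obtain ⟨c, -, hc⟩ := hw
  exact Set.mem_iUnion.2 ⟨c, hc⟩

end CoinPrefix

end Literature.Computability.QuantumComplexity

end
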